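import Summits.AtomisticToContinuum.HydrodynamicLimit.Theorems.EquilibriumClampedCollisionalWindowLD.Negative.LatticeFlow

/-!
# Collision records of the certificate on the window (helper file of the refutation of `EquilibriumClampedCollisionalWindowLD`, stmt-AtomisticToContinuum-13733; see `Cruxes/EquilibriumClampedCollisionalWindowLD/Disproof.lean` and the evidence WITNESS.md; no Theses declaration is asserted positively; refuter-cdisprove-stmt-AtomisticToContinuum-13733-0)
-/

noncomputable section

open Real
open scoped InnerProductSpace

namespace Summit.AtomisticToContinuum.HydrodynamicLimit.Theorems

namespace EquilibriumClampedCollisionalWindowLDNegative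

section Lattice

open Literature.Analysis.FluidPDE Literature.Analysis.FunctionSpaces
open Filter
open scoped Topology

namespace Lat

variable {Λ : Lat} {N : ℕ} {a : Fin (N + 1) ≃ Λ.Slot}

/-! ### Collision records of the certificate on the window -/

section Records

/-- **Collision sums only see the curve on the time set.** [folklore] -/
theorem collisionSum_congr_of_eqOn {M : Type*} [AddCommMonoid M] {γ γ' : ℝ → Cfg N} {S : Set ℝ} {ε : ℝ}
    (h : Set.EqOn γ γ' S) (F : HardSphereCollisionRecord (Fin 3) (UnitAddTorus (Fin 3)) (N + 1) → M) :
    collisionSum (Torus.geometry (Fin 3)) ε γ S F = collisionSum (Torus.geometry (Fin 3)) ε γ' S F := by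
  unfold collisionSum collisionPairSum
  have hT : collisionTimes (Torus.geometry (Fin 3)) ε γ ∩ S = collisionTimes (Torus.geometry (Fin 3)) ε γ' ∩ S := by
    ext t
    simp only [Set.mem_inter_iff, mem_collisionTimes]
    constructor
    · rintro ⟨⟨i, j, hij, hc⟩, ht⟩; exact ⟨⟨i, j, hij, by rwa [← h ht]⟩, ht⟩
    · rintro ⟨⟨i, j, hij, hc⟩, ht⟩; exact ⟨⟨i, j, hij, by rwa [h ht]⟩, ht⟩
  rw [hT]
  refine finsum_mem_congr rfl fun t ht => ?_
  simp only [h ht.2]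

/-- The sphere at block `b`, local index `κ`, line `ℓ` (junk `0` off the line). [folklore] -/
def sph (Λ : Lat) {N : ℕ} (a : Fin (N + 1) ≃ Λ.Slot) (b κ : ℕ) (ℓ : Fin Λ.n × Fin Λ.n) : Fin (N + 1) := by
  classical
  exact if h : b * Λ.m + κ < Λ.M then a.symm (Λ.slotOf b κ ℓ h) else 0

/-- The transfer time of the triple `(b, ℓ, j₀)`. [folklore] -/
def ttime (Λ : Lat) {N : ℕ} (a : Fin (N + 1) ≃ Λ.Slot) (z : Cfg N) (tr : ℕ × (Fin Λ.n × Fin Λ.n) × ℕ) : ℝ :=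
  tHit Λ.P (bv 0) (Λ.bdata a z tr.1 tr.2.1) (tr.2.2 + 1)

/-- **The transfers of the window**: triples `(b, ℓ, j₀)` with `b` an active block, `j₀ + 2 ≤ K`
and transfer time `≤ w`. [folklore] -/
def transfers (Λ : Lat) {N : ℕ} (a : Fin (N + 1) ≃ Λ.Slot) (z : Cfg N) : Finset (ℕ × (Fin Λ.n × Fin Λ.n) × ℕ) := by
  classical
  exact ((Finset.range Λ.Q) ×ˢ (Finset.univ ×ˢ Finset.range (Λ.P.K - 1))).filter
    fun tr => Λ.Active tr.1 ∧ Λ.ttime a z tr ≤ Λ.w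

/-- `mem_transfers` (technical, see the section header). [folklore] -/
theorem mem_transfers {z : Cfg N} {tr : ℕ × (Fin Λ.n × Fin Λ.n) × ℕ} :
    tr ∈ Λ.transfers a z ↔ tr.1 < Λ.Q ∧ tr.2.2 + 2 ≤ Λ.P.K ∧ Λ.Active tr.1 ∧ Λ.ttime a z tr ≤ Λ.w := by
  classical
  unfold transfers
  simp only [Finset.mem_filter, Finset.mem_product, Finset.mem_range, Finset.mem_univ, true_and]
  constructor
  · rintro ⟨⟨h1, h2⟩, h3, h4⟩; exact ⟨h1, by omega, h3, h4⟩
  · rintro ⟨h1, h2, h3, h4⟩; exact ⟨⟨h1, by omega⟩, h3, h4⟩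

/-- `sph_eq` (technical, see the section header). [folklore] -/
theorem sph_eq (hΛ : Λ.OK) {b : ℕ} (hb : b < Λ.Q) {κ : ℕ} (hκ : κ ≤ Λ.P.K) (ℓ : Fin Λ.n × Fin Λ.n) :
    a (Λ.sph a b κ ℓ) = Λ.slotOf b κ ℓ (blk_slot_lt hΛ hb hκ) := by
  classical
  unfold sph; rw [dif_pos (blk_slot_lt hΛ hb hκ), Equiv.apply_symm_apply]

/-- Transfer times are positive. [folklore] -/
theorem ttime_pos (hΛ : Λ.OK) {z : Cfg N} (hz : z ∈ Λ.Ev a) {tr : ℕ × (Fin Λ.n × Fin Λ.n) × ℕ}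
    (htr : tr ∈ Λ.transfers a z) : 0 < Λ.ttime a z tr := by
  obtain ⟨hb, hj, hact, -⟩ := mem_transfers.1 htr
  have hD := dataOK_of_mem hΛ hz hact tr.2.1
  have := tHit_strictMonoOn hΛ.sep.adm hD (Nat.succ_pos tr.2.2) (by omega : tr.2.2 + 1 ≤ Λ.P.K)
  simpa [ttime] using this

/-- Transfer times are jump times of the certificate. [folklore] -/
theorem ttime_mem_jumps {z : Cfg N} {tr : ℕ × (Fin Λ.n × Fin Λ.n) × ℕ}
    (htr : tr ∈ Λ.transfers a z) : Λ.ttime a z tr ∈ Λ.jumps a z := by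
  obtain ⟨hb, hj, hact, hw⟩ := mem_transfers.1 htr
  exact ⟨hw, tr.1, hb, tr.2.1, hact, tHit_mem_jumpTimes (by omega) (by omega)⟩

/-- **The transferring pair is in contact** at its transfer time, with separation `-(ε n)`. [folklore] -/
theorem sepVec_sph (hW : Λ.WinOK) {z : Cfg N} (hz : z ∈ Λ.Ev a) {tr : ℕ × (Fin Λ.n × Fin Λ.n) × ℕ}
    (htr : tr ∈ Λ.transfers a z) :
    (Torus.geometry (Fin 3)).sepVec (Λ.cert a z (Λ.ttime a z tr) (Λ.sph a tr.1 tr.2.2 tr.2.1)).1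
        (Λ.cert a z (Λ.ttime a z tr) (Λ.sph a tr.1 (tr.2.2 + 1) tr.2.1)).1 =
      -(Λ.P.ε • nk Λ.P (bv 0) (Λ.bdata a z tr.1 tr.2.1) tr.2.2) := by
  have hΛ := hW.ok
  obtain ⟨hb, hj, hact, -⟩ := mem_transfers.1 htr
  rw [cert_fst, cert_fst]
  exact sepVec_transfer_pair hW hz hact hj rfl (sph_eq hΛ hb (by omega) _) (sph_eq hΛ hb (by omega) _)

/-- The two spheres of a transfer are distinct. [folklore] -/
theorem sph_ne (hΛ : Λ.OK) {b : ℕ} (hb : b < Λ.Q) {j₀ : ℕ} (hj : j₀ + 2 ≤ Λ.P.K) (ℓ : Fin Λ.n × Fin Λ.n) :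
    Λ.sph a b j₀ ℓ ≠ Λ.sph a b (j₀ + 1) ℓ := by
  intro h
  have := congrArg (fun r => Λ.loc (a r)) h
  simp only [sph_eq hΛ hb (by omega : j₀ ≤ Λ.P.K), sph_eq hΛ hb (by omega : j₀ + 1 ≤ Λ.P.K)] at this
  rw [(blk_symm_slotOf hΛ (by have := hΛ.K_eq; omega) ℓ _).2.1,
    (blk_symm_slotOf hΛ (by have := hΛ.K_eq; omega) ℓ _).2.1] at this
  omega

end Records

section Window

variable (Φ : HardSphereFlow (Torus.geometry (Fin 3)) Λ.P.ε (N + 1))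

/-- The first sphere of a transfer (the spent carrier). [folklore] -/
abbrev sphI (Λ : Lat) {N : ℕ} (a : Fin (N + 1) ≃ Λ.Slot) (tr : ℕ × (Fin Λ.n × Fin Λ.n) × ℕ) : Fin (N + 1) :=
  Λ.sph a tr.1 tr.2.2 tr.2.1
/-- The second sphere of a transfer (the new carrier). [folklore] -/
abbrev sphJ (Λ : Lat) {N : ℕ} (a : Fin (N + 1) ≃ Λ.Slot) (tr : ℕ × (Fin Λ.n × Fin Λ.n) × ℕ) : Fin (N + 1) :=
  Λ.sph a tr.1 (tr.2.2 + 1) tr.2.1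

variable {Φ}

/-- The torus geometry is hard-sphere regular at the block diameter. [folklore] -/
theorem regular (hP : Λ.P.Admissible) (hε : Λ.P.ε < 1 / 2) : (Torus.geometry (Fin 3)).IsHardSphereRegular Λ.P.ε :=
  Torus.isHardSphereRegular_geometry (by have := hP.ε_pos; linarith)

/-- **Transfers are collisions of the flow.** [folklore] -/
theorem ttime_mem_collisionTimes (hW : Λ.WinOK) {z : Cfg N} (hz : z ∈ Λ.Ev a) (hgood : z ∈ Φ.good)
    {tr : ℕ × (Fin Λ.n × Fin Λ.n) × ℕ} (htr : tr ∈ Λ.transfers a z) :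
    (fun t => Φ.flow t z) (Λ.ttime a z tr) ∈
        contactSet (Torus.geometry (Fin 3)) (N + 1) Λ.P.ε (Λ.sphI a tr) (Λ.sphJ a tr) ∧
      Λ.ttime a z tr ∈ collisionTimes (Torus.geometry (Fin 3)) Λ.P.ε (fun t => Φ.flow t z) ∩ Set.Ioc 0 Λ.w := by
  have hΛ := hW.ok
  have hP := hΛ.sep.adm
  obtain ⟨hb, hj, hact, hw⟩ := mem_transfers.1 htr
  have ht0 := ttime_pos hΛ hz htr
  have heq := flow_eqOn_cert hW hz Φ hgood ⟨ht0.le, hw⟩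
  simp only at heq
  have hsv := sepVec_sph hW hz htr
  have hD := dataOK_of_mem hΛ hz hact tr.2.1
  have hn1 : ‖nk Λ.P (bv 0) (Λ.bdata a z tr.1 tr.2.1) tr.2.2‖ = 1 :=
    (stepFacts hP hD (by omega : tr.2.2 + 1 ≤ Λ.P.K)).cont.n_unit
  have hcontact : (fun t => Φ.flow t z) (Λ.ttime a z tr) ∈
      contactSet (Torus.geometry (Fin 3)) (N + 1) Λ.P.ε (Λ.sphI a tr) (Λ.sphJ a tr) := by
    refine mem_contactSet.2 ⟨(Φ.isTrajectory z hgood).mem _, ?_⟩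
    show ‖(Torus.geometry (Fin 3)).sepVec (Φ.flow (Λ.ttime a z tr) z (Λ.sphI a tr)).1
        (Φ.flow (Λ.ttime a z tr) z (Λ.sphJ a tr)).1‖ = Λ.P.ε
    rw [heq, hsv, norm_neg, norm_smul, hn1, mul_one, Real.norm_of_nonneg hP.ε_pos.le]
  exact ⟨hcontact, ⟨mem_collisionTimes.2 ⟨_, _, sph_ne hΛ hb hj _, hcontact⟩, ht0, hw⟩⟩

/-- **Collisions of the flow in the window are transfers.** [folklore] -/
theorem exists_transfer_of_mem (hW : Λ.WinOK) {z : Cfg N} (hz : z ∈ Λ.Ev a) (hgood : z ∈ Φ.good) {t : ℝ}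
    (ht : t ∈ collisionTimes (Torus.geometry (Fin 3)) Λ.P.ε (fun t => Φ.flow t z) ∩ Set.Ioc 0 Λ.w) :
    ∃ tr ∈ Λ.transfers a z, Λ.ttime a z tr = t := by
  have hΛ := hW.ok
  obtain ⟨⟨i, j, hij, hc⟩, ht0, htw⟩ := ht
  have heq := flow_eqOn_cert hW hz Φ hgood ⟨ht0.le, htw⟩
  simp only at heq hc
  rw [heq] at hc
  have hnorm := (mem_contactSet.1 hc).2
  -- the separation lemma forces a same-block pair at a jump time
  have key : Λ.SameBlk a i j ∧ t ∈ jumpTimes Λ.P (bv 0) (Λ.bdata a z (Λ.blk (a i)) (a i).2) := by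
    by_contra h
    have hsep := cert_sep hW hz ht0.le htw hij (fun hsb hjt => h ⟨hsb, hjt⟩)
    rw [hnorm] at hsep; exact lt_irrefl _ hsep
  obtain ⟨hsb, hjt⟩ := key
  obtain ⟨j', hj1, hj2, hjt'⟩ := mem_jumpTimes.1 hjt
  refine ⟨(Λ.blk (a i), (a i).2, j' - 1), mem_transfers.2 ⟨hsb.1.1, (by show j' - 1 + 2 ≤ Λ.P.K; omega), hsb.1, ?_⟩, ?_⟩
  · show tHit Λ.P (bv 0) (Λ.bdata a z (Λ.blk (a i)) (a i).2) (j' - 1 + 1) ≤ Λ.w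
    rw [Nat.sub_add_cancel hj1, hjt']; exact htw
  · show tHit Λ.P (bv 0) (Λ.bdata a z (Λ.blk (a i)) (a i).2) (j' - 1 + 1) = t
    rw [Nat.sub_add_cancel hj1, hjt']

/-- Slot facts of the two spheres of a transfer. [folklore] -/
theorem sphI_facts (hΛ : Λ.OK) {z : Cfg N} {tr : ℕ × (Fin Λ.n × Fin Λ.n) × ℕ} (htr : tr ∈ Λ.transfers a z) :
    Λ.blk (a (Λ.sphI a tr)) = tr.1 ∧ Λ.loc (a (Λ.sphI a tr)) = tr.2.2 ∧ (a (Λ.sphI a tr)).2 = tr.2.1 := by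
  obtain ⟨hb, hj, -, -⟩ := mem_transfers.1 htr
  exact slot_facts hΛ (by have := hΛ.K_eq; omega) (sph_eq hΛ hb (by omega) _)

/-- `sphJ_facts` (technical, see the section header). [folklore] -/
theorem sphJ_facts (hΛ : Λ.OK) {z : Cfg N} {tr : ℕ × (Fin Λ.n × Fin Λ.n) × ℕ} (htr : tr ∈ Λ.transfers a z) :
    Λ.blk (a (Λ.sphJ a tr)) = tr.1 ∧ Λ.loc (a (Λ.sphJ a tr)) = tr.2.2 + 1 ∧ (a (Λ.sphJ a tr)).2 = tr.2.1 := by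
  obtain ⟨hb, hj, -, -⟩ := mem_transfers.1 htr
  exact slot_facts hΛ (by have := hΛ.K_eq; omega) (sph_eq hΛ hb (by omega) _)

/-- **Distinct transfers happen at distinct times** (on the good set: two disjoint pairs in contact
at once are excluded by the trajectory's `binary` axiom). [folklore] -/
theorem ttime_injOn (hW : Λ.WinOK) {z : Cfg N} (hz : z ∈ Λ.Ev a) (hgood : z ∈ Φ.good) :
    Set.InjOn (Λ.ttime a z) (Λ.transfers a z : Set (ℕ × (Fin Λ.n × Fin Λ.n) × ℕ)) := by
  have hΛ := hW.ok
  intro tr htr tr' htr' heq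
  have htr0 := Finset.mem_coe.1 htr
  have htr0' := Finset.mem_coe.1 htr'
  obtain ⟨hc, -⟩ := ttime_mem_collisionTimes hW hz hgood htr0
  obtain ⟨hc', -⟩ := ttime_mem_collisionTimes hW hz hgood htr0'
  rw [← heq] at hc'
  obtain ⟨hb, hj, -, -⟩ := mem_transfers.1 htr0
  obtain ⟨hb', hj', -, -⟩ := mem_transfers.1 htr0'
  have huniq := ((Φ.isTrajectory z hgood).binary (Λ.ttime a z tr) _ _ (sph_ne hΛ hb hj _) hc).1
    _ _ (sph_ne hΛ hb' hj' _) hc'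
  obtain ⟨f1, f2, f3⟩ := sphI_facts hΛ htr0
  obtain ⟨g1, g2, g3⟩ := sphJ_facts hΛ htr0
  obtain ⟨f1', f2', f3'⟩ := sphI_facts hΛ htr0'
  obtain ⟨g1', g2', g3'⟩ := sphJ_facts hΛ htr0'
  have hI : Λ.sphI a tr' ∈ ({Λ.sphI a tr, Λ.sphJ a tr} : Finset (Fin (N + 1))) := by rw [← huniq]; simp
  have hJ : Λ.sphJ a tr' ∈ ({Λ.sphI a tr, Λ.sphJ a tr} : Finset (Fin (N + 1))) := by rw [← huniq]; simp
  simp only [Finset.mem_insert, Finset.mem_singleton] at hI hJ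
  rcases hI with h | h
  · have e1 := congrArg (fun r => Λ.blk (a r)) h
    have e2 := congrArg (fun r => Λ.loc (a r)) h
    have e3 := congrArg (fun r => (a r).2) h
    simp only [f1, f2, f3, f1', f2', f3'] at e1 e2 e3
    exact Prod.ext e1.symm (Prod.ext e3.symm e2.symm)
  · have e2 := congrArg (fun r => Λ.loc (a r)) h
    simp only [f2', g2] at e2
    rcases hJ with h' | h'
    · have e2' := congrArg (fun r => Λ.loc (a r)) h'
      simp only [g2', f2] at e2'; omega
    · have e2' := congrArg (fun r => Λ.loc (a r)) h'
      simp only [g2', g2] at e2'; omega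

/-- **The contact pairs at a transfer** are the transferring pair in its two orders. [folklore] -/
theorem contactPairs_ttime (hW : Λ.WinOK) (hε : Λ.P.ε < 1 / 2) {z : Cfg N} (hz : z ∈ Λ.Ev a) (hgood : z ∈ Φ.good)
    {tr : ℕ × (Fin Λ.n × Fin Λ.n) × ℕ} (htr : tr ∈ Λ.transfers a z) :
    contactPairs (Torus.geometry (Fin 3)) Λ.P.ε ((fun t => Φ.flow t z) (Λ.ttime a z tr)) =
      {(Λ.sphI a tr, Λ.sphJ a tr), (Λ.sphJ a tr, Λ.sphI a tr)} := by
  have hΛ := hW.ok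
  obtain ⟨hb, hj, -, -⟩ := mem_transfers.1 htr
  obtain ⟨hc, -⟩ := ttime_mem_collisionTimes hW hz hgood htr
  exact (Φ.isTrajectory z hgood).contactPairs_eq_pair (regular hΛ.sep.adm hε)
    (mem_contactPairs.2 ⟨sph_ne hΛ hb hj _, hc⟩)

/-- **The collision sum of the window as a sum over transfers.** [folklore] -/
theorem collisionSum_window {M : Type*} [AddCommMonoid M] (hW : Λ.WinOK) (hε : Λ.P.ε < 1 / 2) {z : Cfg N}
    (hz : z ∈ Λ.Ev a) (hgood : z ∈ Φ.good) (F : HardSphereCollisionRecord (Fin 3) (UnitAddTorus (Fin 3)) (N + 1) → M) :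
    Φ.collisionSum (Set.Ioc 0 Λ.w) F z =
      ∑ tr ∈ Λ.transfers a z,
        (F (HardSphereCollisionRecord.ofConfig (Torus.geometry (Fin 3)) Λ.P.ε (Λ.cert a z (Λ.ttime a z tr))
            (Λ.ttime a z tr) (Λ.sphI a tr) (Λ.sphJ a tr)) +
         F (HardSphereCollisionRecord.ofConfig (Torus.geometry (Fin 3)) Λ.P.ε (Λ.cert a z (Λ.ttime a z tr))
            (Λ.ttime a z tr) (Λ.sphJ a tr) (Λ.sphI a tr))) := by
  classical
  have hΛ := hW.ok
  set γ : ℝ → Cfg N := fun t => Φ.flow t z with hγ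
  have hfin : (collisionTimes (Torus.geometry (Fin 3)) Λ.P.ε γ ∩ Set.Ioc 0 Λ.w).Finite :=
    Φ.finite_collisionTimes_inter hgood Set.Ioc_subset_Icc_self
  rw [HardSphereFlow.collisionSum_eq, collisionSum_eq_finset_sum hfin]
  have hset : hfin.toFinset = (Λ.transfers a z).image (Λ.ttime a z) := by
    ext t
    rw [Set.Finite.mem_toFinset, Finset.mem_image]
    constructor
    · intro ht; exact exists_transfer_of_mem hW hz hgood ht
    · rintro ⟨tr, htr, rfl⟩; exact (ttime_mem_collisionTimes hW hz hgood htr).2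
  rw [hset, Finset.sum_image (fun tr htr tr' htr' h => ttime_injOn hW hz hgood htr htr' h)]
  refine Finset.sum_congr rfl fun tr htr => ?_
  obtain ⟨hb, hj, -, hw⟩ := mem_transfers.1 htr
  have hne := sph_ne (a := a) hΛ hb hj tr.2.1
  rw [contactPairs_ttime hW hε hz hgood htr, Finset.sum_pair (fun h => hne (Prod.mk.inj h).1)]
  have heq : γ (Λ.ttime a z tr) = Λ.cert a z (Λ.ttime a z tr) :=
    flow_eqOn_cert hW hz Φ hgood ⟨(ttime_pos hΛ hz htr).le, hw⟩
  simp only [heq]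

end Window

end Lat

end Lattice

end EquilibriumClampedCollisionalWindowLDNegative

end Summit.AtomisticToContinuum.HydrodynamicLimit.Theorems

end
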